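import Summits.QuantumFields.YangMills.Theorems.BalabanUVNodesN15KingModelGraphPowerCountingKruskal

/-!
# BalabanUVNodes ∕ N15 — THE KING-MODEL RUNG (PART Α-b): THE TREE LENGTH OF THE EXTERNAL POINTS — «the length of the shortest tree graph connecting {u_i}»
# as a minimum over finite connecting edge sets, and the fact that drives (3.56)'s decay: a CONNECTED graph placed on the lattice, with legs to its
# anchored external points, has total line length at least the tree length of the anchors, so the product of the per-line decay weights is at most
# `exp[−δ·(tree length)]` at every placement
# (Track A, DAG node N15 = NE2; FAN-OUT v1.1 §N15 s3 «KING-MODEL RUNG … NE2's analogue DECIDED in the model»)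

HONEST FRAMING.  Count-neutral (cell `pub-ymgap`, seat `pub-ymgap-dag-n15-e` g29; `--supports stmt-QuantumFields-27366 --as helper` = K3⁸
`SpineGivenEndpointR13SepCoPHV`).  TEMPLATE LITERATURE: C. King, *The U(1) Higgs model. I. The continuum limit*, Commun. Math. Phys. **102** (1986) 649–677
[King1986], p. 660 (the tree distance of Theorem 3.5 ∕ Proposition 3.6) and p. 664 (the extraction of the decay).  Finite combinatorics on a finite site
sort; the connectedness of the abstract graph is part Γ-k's `LConn`.  NOT Bałaban's `G(U)`; NOT a node discharge; nothing continuum ∕ ℝ⁴ ∕ OS ∕ mass-gap ∕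
Clay.  0 `sorry`; standard axioms.  Text layer of pp. 660–664 (`paper:king1986-cmp102-king-u1-higgs-i` p0012–p0016) re-read by this seat 2026-08-29.

THE PRINT.  p. 660 [PDF 12], verbatim: *«The next theorem expresses the results of this section. We define dist({u_i}) to be the length of the shortest tree
graph connecting {u_i}.»*; (3.38)–(3.39) and (3.56) then carry *«exp[−δ dist({y_i}, {z_j})]»* ∕ *«exp[−δ d(…, {y_i}, {z_q}, {w_l})]»*; p. 664 [PDF 16]: *«By
extracting a small part of each propagator, we get the exponential decay on the right-hand side of (3.56).»*

READING (declared; ours).  (i) THE TREE LENGTH.  On a finite site sort `T` with a length `ρ : T → T → ℝ`, a finite EDGE SET `E ⊆ T × T` CONNECTS a finite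
point set `U` when any two points of `U` are joined by a chain of edges of `E` (orientation immaterial); `treeLength ρ U` is the MINIMUM over the connecting
edge sets of the total length `Σ_{(a,b) ∈ E} ρ(a, b)` (the family is finite and contains `T × T`).  For `ρ ≥ 0` the minimum is attained at a tree (drop the
edges closing cycles), so this IS King's «length of the shortest tree graph connecting {u_i}»; the pruning is not typed — every use below is through the two
inequalities `treeLength ρ U ≤ Σ_E ρ` (any connecting `E`) and, for a pseudometric `ρ`, `ρ(u, v) ≤ treeLength ρ U` (`u, v ∈ U`).  (ii) WHY THE DECAY COMES OUT.
A graph in part Η-a's flat spelling — vertices `0, …, nn`, internal lines `src ℓ → tgt ℓ`, one-vertex factors `υ` at `vtx υ`, some of them ANCHORED at an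
external point `anch υ = some y_υ` (an external line to `y_υ`, a field held at `w_l`, …) — placed at `σ : Fin (nn+1) → T` draws the edge set
`{(σ(src ℓ), σ(tgt ℓ))} ∪ {(σ(vtx υ), y_υ)}`; if the abstract graph is CONNECTED (part Γ-k `LConn src tgt univ 0 v` for all `v`) this edge set connects the anchors,
so `treeLength ρ {y_υ} ≤ Σ_ℓ ρ(σ(src ℓ), σ(tgt ℓ)) + Σ_υ ρ(σ(vtx υ), y_υ)` and the product of the weights `exp[−δρ]` over lines and anchored legs is at most
`exp[−δ·treeLength ρ {y_υ}]` — AT EVERY PLACEMENT, which is the hypothesis `hΘ` of part Α-a's weighted engine.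

WHAT THIS FILE PROVES (namespace `Summit.QuantumFields.YangMills.BalabanUVNodes.N15KingModelRung.Graph`).
* §1 `EAdj`∕`EConn` (chains of edges, `Relation.ReflTransGen` of the symmetrised edge relation), `Connects`, `edgeLength`, `treeLength`; `connects_univ`,
  ★ `treeLength_le_edgeLength`, `exists_connects_edgeLength_eq`, `treeLength_nonneg`, `treeLength_of_card_le_one` (`|U| ≤ 1 ⇒ 0`).
* §2 ★ **`le_treeLength`** — for a pseudometric `ρ` (`ρ ≥ 0`, `ρ(a, a) = 0`, symmetric, triangle) and `u, v ∈ U`: `ρ(u, v) ≤ treeLength ρ U` (strong induction on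
  the connecting edge set: cut the chain at its last edge); `treeLength_pair` (`treeLength ρ {u, v} = ρ(u, v)`).  So the tree length is an honest length: between
  the diameter and the length of any connecting tree.
* §3 `anchors`∕`legLength`∕`legWeight` (anchored one-vertex factors, `anch : Υ → Option T`), `placedEdges`; ★ `eConn_placed_of_lConn` (part Γ-k's connectedness
  transported along `σ`), ★★ `connects_placedEdges` (a connected placed graph connects its anchors), ★★ **`treeLength_anchors_le`**
  (`treeLength ρ (anchors anch) ≤ Σ_ℓ ρ(σ(src ℓ), σ(tgt ℓ)) + Σ_υ legLength`), ★★★ **`prod_lineWeight_mul_prod_legWeight_le`** (for `δ ≥ 0`, `ρ ≥ 0` and a connected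
  graph: `Π_ℓ exp[−δρ(σ(src ℓ), σ(tgt ℓ))]·Π_υ legWeight δ ρ (anch υ) (σ(vtx υ)) ≤ exp[−δ·treeLength ρ (anchors anch)]` at every placement `σ`).

HONEST SCOPE.  (a) Finite combinatorics; no lattice, no propagator.  (b) `treeLength` minimises over connecting edge sets, equal to King's tree minimum for
`ρ ≥ 0` by pruning (not typed; only the displayed inequalities are used downstream).  (c) Unanchored factors (`anch υ = none`) carry weight `1` and do not enter
the tree.  Locators: [King1986] p.660 («shortest tree graph connecting {u_i}»), (3.38)–(3.39) p.660, Prop. 3.6 (3.56) p.662, p.664 («By extracting a small part …»).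
(v1.1: module docstring only — re-filed to re-trigger the hub build of this module; every declaration byte-identical to v1.0, p731964.)
-/

noncomputable section
namespace Summit.QuantumFields.YangMills.BalabanUVNodes.N15KingModelRung.Graph

open scoped BigOperators
open Finset

/-! ## §1 Connecting edge sets and the tree length -/

section TreeLength
variable {T : Type*}

/-- adjacency through a finite edge set, orientation immaterial. [folklore] -/
def EAdj (E : Finset (T × T)) (a b : T) : Prop := (a, b) ∈ E ∨ (b, a) ∈ E

/-- **joined by a chain of edges of `E`** (the reflexive-transitive closure of `EAdj E`). [cite: King1986, p.660 («tree graph connecting {u_i}»)] -/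
def EConn (E : Finset (T × T)) : T → T → Prop := Relation.ReflTransGen (EAdj E)

/-- **`E` CONNECTS `U`**: any two points of `U` are joined by a chain of edges of `E`. [cite: King1986, p.660 («tree graph connecting {u_i}»)] -/
def Connects (U : Finset T) (E : Finset (T × T)) : Prop := ∀ u ∈ U, ∀ v ∈ U, EConn E u v

/-- **the total length of an edge set** `Σ_{(a,b) ∈ E} ρ(a, b)`. [cite: King1986, p.660 («the length of the shortest tree graph»)] -/
def edgeLength (ρ : T → T → ℝ) (E : Finset (T × T)) : ℝ := ∑ e ∈ E, ρ e.1 e.2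

/-- adjacency is symmetric. [folklore] -/
theorem eAdj_symm {E : Finset (T × T)} {a b : T} (h : EAdj E a b) : EAdj E b a := h.symm

/-- adjacency is monotone in the edge set. [folklore] -/
theorem eAdj_mono {E E' : Finset (T × T)} (hEE : E ⊆ E') {a b : T} (h : EAdj E a b) : EAdj E' a b :=
  h.imp (fun h => hEE h) fun h => hEE h

/-- one edge joins its endpoints. [folklore] -/
theorem eConn_of_mem {E : Finset (T × T)} {a b : T} (h : (a, b) ∈ E) : EConn E a b := Relation.ReflTransGen.single (Or.inl h)

/-- chains reverse (the edge relation is symmetric). [folklore] -/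
theorem eConn_symm {E : Finset (T × T)} {a b : T} (h : EConn E a b) : EConn E b a := by
  induction h with
  | refl => exact Relation.ReflTransGen.refl
  | tail _ hbc ih => exact Relation.ReflTransGen.head (eAdj_symm hbc) ih

/-- chains compose. [folklore] -/
theorem eConn_trans {E : Finset (T × T)} {a b c : T} (h₁ : EConn E a b) (h₂ : EConn E b c) : EConn E a c := Relation.ReflTransGen.trans h₁ h₂

/-- chains are monotone in the edge set. [folklore] -/
theorem eConn_mono {E E' : Finset (T × T)} (hEE : E ⊆ E') {a b : T} (h : EConn E a b) : EConn E' a b := by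
  induction h with
  | refl => exact Relation.ReflTransGen.refl
  | tail _ hbc ih => exact ih.tail (eAdj_mono hEE hbc)

variable [Fintype T]

/-- the full edge set `T × T` connects everything. [folklore] -/
theorem connects_univ (U : Finset T) : Connects U (univ : Finset (T × T)) := fun u _ v _ => eConn_of_mem (mem_univ (u, v))

/-- ★ **THE TREE LENGTH OF A FINITE POINT SET** — King p. 660 *«the length of the shortest tree graph connecting {u_i}»*: the minimum over the (finitely many)
edge sets `E ⊆ T × T` connecting `U` of their total length `Σ_E ρ`.  (For `ρ ≥ 0` the minimum is attained at a tree — prune the cycles; only the inequalities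
below are used.) [cite: King1986, p.660 («We define dist({u_i}) to be the length of the shortest tree graph connecting {u_i}»), (3.56) p.662] -/
def treeLength (ρ : T → T → ℝ) (U : Finset T) : ℝ := by
  classical
  exact ((univ : Finset (Finset (T × T))).filter (Connects U)).inf' ⟨univ, mem_filter.2 ⟨mem_univ _, connects_univ U⟩⟩ (edgeLength ρ)

/-- ★ **ANY CONNECTING EDGE SET IS AT LEAST AS LONG AS THE TREE LENGTH**: `Connects U E ⇒ treeLength ρ U ≤ Σ_E ρ`. [cite: King1986, p.660 («shortest tree graph
connecting {u_i}»)] -/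
theorem treeLength_le_edgeLength (ρ : T → T → ℝ) {U : Finset T} {E : Finset (T × T)} (hE : Connects U E) : treeLength ρ U ≤ edgeLength ρ E := by
  classical
  unfold treeLength; exact inf'_le (edgeLength ρ) (mem_filter.2 ⟨mem_univ E, hE⟩)

/-- the tree length is attained: some connecting edge set has exactly that length. [cite: King1986, p.660 («shortest tree graph connecting {u_i}»)] -/
theorem exists_connects_edgeLength_eq (ρ : T → T → ℝ) (U : Finset T) : ∃ E : Finset (T × T), Connects U E ∧ edgeLength ρ E = treeLength ρ U := by
  classical
  obtain ⟨E, hE, h⟩ := exists_mem_eq_inf' (s := (univ : Finset (Finset (T × T))).filter (Connects U))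
    ⟨univ, mem_filter.2 ⟨mem_univ _, connects_univ U⟩⟩ (edgeLength ρ)
  exact ⟨E, (mem_filter.1 hE).2, by unfold treeLength; exact h.symm⟩

/-- the tree length is nonnegative for a nonnegative length. [cite: King1986, p.660] -/
theorem treeLength_nonneg {ρ : T → T → ℝ} (hρ : ∀ a b, 0 ≤ ρ a b) (U : Finset T) : 0 ≤ treeLength ρ U := by
  obtain ⟨E, -, h⟩ := exists_connects_edgeLength_eq ρ U
  rw [← h]; exact sum_nonneg fun e _ => hρ _ _

/-- at most one point needs no edge: `|U| ≤ 1 ⇒ treeLength ρ U = 0` for `ρ ≥ 0` (the empty edge set connects `U`). [cite: King1986, p.660] -/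
theorem treeLength_of_card_le_one {ρ : T → T → ℝ} (hρ : ∀ a b, 0 ≤ ρ a b) {U : Finset T} (hU : U.card ≤ 1) : treeLength ρ U = 0 := by
  refine le_antisymm ?_ (treeLength_nonneg hρ U)
  have hE : Connects U (∅ : Finset (T × T)) := fun u hu v hv => by
    rw [card_le_one.1 hU u hu v hv]; exact Relation.ReflTransGen.refl
  have h := treeLength_le_edgeLength ρ hE; rwa [edgeLength, sum_empty] at h

end TreeLength

/-! ## §2 The tree length dominates the distances (pseudometric lengths) -/

section LowerBound
variable {T : Type*} [DecidableEq T]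

omit [DecidableEq T] in
/-- **CUTTING A CHAIN AT A REMOVED EDGE**: if every edge of `E` missing from `E′` has endpoints `{a, b}`, then a chain of `E` from `u` either survives in `E′`
or reaches `a` or `b` through `E′` (cut at the first missing edge). [folklore] -/
theorem eConn_cut {E E' : Finset (T × T)} {a b : T}
    (hrest : ∀ e ∈ E, e ∉ E' → (e.1 = a ∧ e.2 = b) ∨ (e.1 = b ∧ e.2 = a)) {u w : T} (h : EConn E u w) :
    EConn E' u w ∨ EConn E' u a ∨ EConn E' u b := by
  induction h with
  | refl => exact Or.inl Relation.ReflTransGen.refl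
  | @tail w' w _ hedge ih =>
      rcases ih with h1 | h2
      · by_cases hE' : EAdj E' w' w
        · exact Or.inl (h1.tail hE')
        · -- the edge `{w', w}` lies in `E ∖ E′`, so it is `{a, b}` and `w' ∈ {a, b}`
          have hw' : w' = a ∨ w' = b := by
            rcases hedge with he | he
            · have hne : (w', w) ∉ E' := fun h => hE' (Or.inl h)
              exact (hrest _ he hne).imp (fun h => h.1) fun h => h.1
            · have hne : (w, w') ∉ E' := fun h => hE' (Or.inr h)
              exact ((hrest _ he hne).imp (fun h => h.2) fun h => h.2).symm
          rcases hw' with rfl | rfl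
          exacts [Or.inr (Or.inl h1), Or.inr (Or.inr h1)]
      · exact Or.inr h2

/-- ★ **A CONNECTING EDGE SET IS AT LEAST AS LONG AS ANY DISTANCE IT BRIDGES**: for a pseudometric length `ρ` (nonnegative, `ρ(a, a) = 0`, symmetric, triangle
inequality), a chain of edges of `E` from `u` to `v` forces `ρ(u, v) ≤ Σ_E ρ` — strong induction on `E`: cut the chain at its last edge `{c, v}`; either `u`
reaches `c` avoiding that edge (induction on `E` minus the edge, plus `ρ(c, v)`), or `u` reaches `v` avoiding it. [folklore] -/
theorem dist_le_edgeLength_of_eConn {ρ : T → T → ℝ} (hρ0 : ∀ a b, 0 ≤ ρ a b) (hρr : ∀ a, ρ a a = 0) (hρs : ∀ a b, ρ a b = ρ b a)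
    (hρt : ∀ a b c, ρ a c ≤ ρ a b + ρ b c) :
    ∀ (E : Finset (T × T)) (u v : T), EConn E u v → ρ u v ≤ edgeLength ρ E := by
  intro E
  induction E using Finset.strongInduction with
  | H E IH =>
    intro u v h
    have hlen0 : ∀ E₀ : Finset (T × T), 0 ≤ edgeLength ρ E₀ := fun E₀ => sum_nonneg fun e _ => hρ0 _ _
    rcases Relation.ReflTransGen.cases_tail h with rfl | ⟨c, hc, hcv⟩
    · rw [hρr]; exact hlen0 E
    · -- remove the last edge `{c, v}` in both orientations
      set E' : Finset (T × T) := (E.erase (c, v)).erase (v, c) with hE'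
      have hsub : E' ⊆ E := fun e he => mem_of_mem_erase (mem_of_mem_erase he)
      have hmemE : (c, v) ∈ E ∨ (v, c) ∈ E := hcv
      have hne : E' ≠ E := by
        intro hEq
        rcases hmemE with hm | hm
        · have : (c, v) ∈ E' := by rw [hEq]; exact hm
          rw [hE'] at this
          exact (notMem_erase (c, v) E) (mem_of_mem_erase this)
        · have : (v, c) ∈ E' := by rw [hEq]; exact hm
          rw [hE'] at this
          exact (notMem_erase (v, c) (E.erase (c, v))) this
      have hss : E' ⊂ E := lt_of_le_of_ne hsub hne
      have hrest : ∀ e ∈ E, e ∉ E' → (e.1 = c ∧ e.2 = v) ∨ (e.1 = v ∧ e.2 = c) := by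
        rintro ⟨x, y⟩ he hne'
        rw [hE'] at hne'
        by_cases h1 : (x, y) = (v, c)
        · exact Or.inr ⟨(Prod.mk.inj h1).1, (Prod.mk.inj h1).2⟩
        · by_cases h2 : (x, y) = (c, v)
          · exact Or.inl ⟨(Prod.mk.inj h2).1, (Prod.mk.inj h2).2⟩
          · exact absurd (mem_erase.2 ⟨h1, mem_erase.2 ⟨h2, he⟩⟩) hne'
      -- the removed part of the length pays for `ρ(c, v)`
      have hpay : edgeLength ρ E' + ρ c v ≤ edgeLength ρ E := by
        have hsplit : edgeLength ρ E = edgeLength ρ E' + ∑ e ∈ E \ E', ρ e.1 e.2 := by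
          unfold edgeLength; rw [← sum_sdiff hsub, add_comm]
        rw [hsplit]
        refine add_le_add le_rfl ?_
        rcases hmemE with hm | hm
        · have hm' : (c, v) ∈ E \ E' := mem_sdiff.2 ⟨hm, fun h' => by
            rw [hE'] at h'; exact (notMem_erase (c, v) E) (mem_of_mem_erase h')⟩
          exact single_le_sum (f := fun e : T × T => ρ e.1 e.2) (fun e _ => hρ0 _ _) hm'
        · have hm' : (v, c) ∈ E \ E' := mem_sdiff.2 ⟨hm, fun h' => by
            rw [hE'] at h'; exact (notMem_erase (v, c) (E.erase (c, v))) h'⟩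
          rw [hρs c v]
          exact single_le_sum (f := fun e : T × T => ρ e.1 e.2) (fun e _ => hρ0 _ _) hm'
      rcases eConn_cut hrest hc with h1 | h2 | h3
      · exact ((hρt u c v).trans (add_le_add (IH E' hss u c h1) le_rfl)).trans hpay
      · exact ((hρt u c v).trans (add_le_add (IH E' hss u c h2) le_rfl)).trans hpay
      · exact (IH E' hss u v h3).trans ((le_add_of_nonneg_right (hρ0 c v)).trans hpay)

variable [Fintype T]

/-- ★ **THE TREE LENGTH DOMINATES EVERY DISTANCE INSIDE THE SET**: for a pseudometric `ρ` and `u, v ∈ U`, `ρ(u, v) ≤ treeLength ρ U` — the tree length lies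
between the diameter of `U` and the length of any tree connecting `U`. [cite: King1986, p.660 («the length of the shortest tree graph connecting {u_i}»)] -/
theorem le_treeLength {ρ : T → T → ℝ} (hρ0 : ∀ a b, 0 ≤ ρ a b) (hρr : ∀ a, ρ a a = 0) (hρs : ∀ a b, ρ a b = ρ b a)
    (hρt : ∀ a b c, ρ a c ≤ ρ a b + ρ b c) {U : Finset T} {u v : T} (hu : u ∈ U) (hv : v ∈ U) : ρ u v ≤ treeLength ρ U := by
  obtain ⟨E, hE, h⟩ := exists_connects_edgeLength_eq ρ U
  rw [← h]
  exact dist_le_edgeLength_of_eConn hρ0 hρr hρs hρt E u v (hE u hu v hv)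

/-- **TWO POINTS**: `treeLength ρ {u, v} = ρ(u, v)` for a pseudometric `ρ` (the one-edge tree). [cite: King1986, p.660] -/
theorem treeLength_pair {ρ : T → T → ℝ} (hρ0 : ∀ a b, 0 ≤ ρ a b) (hρr : ∀ a, ρ a a = 0) (hρs : ∀ a b, ρ a b = ρ b a)
    (hρt : ∀ a b c, ρ a c ≤ ρ a b + ρ b c) (u v : T) : treeLength ρ ({u, v} : Finset T) = ρ u v := by
  refine le_antisymm ?_ (le_treeLength hρ0 hρr hρs hρt (mem_insert_self u {v}) (mem_insert_of_mem (mem_singleton_self v)))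
  have hE : Connects ({u, v} : Finset T) ({(u, v)} : Finset (T × T)) := by
    intro a ha b hb
    simp only [mem_insert, mem_singleton] at ha hb
    have huv : EConn ({(u, v)} : Finset (T × T)) u v := eConn_of_mem (mem_singleton_self _)
    rcases ha with rfl | rfl <;> rcases hb with rfl | rfl
    · exact Relation.ReflTransGen.refl
    · exact huv
    · exact eConn_symm huv
    · exact Relation.ReflTransGen.refl
  have h := treeLength_le_edgeLength ρ hE
  rwa [edgeLength, sum_singleton] at h

end LowerBound

/-! ## §3 A connected placed graph with anchored legs connects its anchors: the decay weights' product is at most `exp[−δ·treeLength]` -/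

section Placement
variable {T : Type*} [DecidableEq T] {nn m : ℕ} (src tgt : Fin m → Fin (nn + 1)) {Υ : Type*} [Fintype Υ] (vtx : Υ → Fin (nn + 1))
  (anch : Υ → Option T)

/-- **THE ANCHORS** — the external points the anchored one-vertex factors are tied to (`anch υ = some y_υ`: an external line to `y_υ`, a field held at `w_l`;
`anch υ = none`: a source, a dressing, an unanchored sup). [cite: King1986, (3.55)–(3.56) p.662 («{y_i}, {z_q}, {w_l}»)] -/
def anchors : Finset T := (univ : Finset Υ).biUnion fun υ => (anch υ).toFinset

omit [DecidableEq T] in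
/-- **THE LEG LENGTH** of an anchored factor at a placement: `ρ(σ(vtx υ), y_υ)` (`0` if unanchored). [cite: King1986, (3.56) p.662] -/
def legLength (ρ : T → T → ℝ) (σ : Fin (nn + 1) → T) (υ : Υ) : ℝ := (anch υ).elim 0 fun y => ρ (σ (vtx υ)) y

omit [DecidableEq T] in
/-- **THE LEG WEIGHT** of a factor read at the lattice point `x`: `exp[−δρ(x, y_υ)]` if anchored at `y_υ`, `1` if not — the «small part» extracted from an external
line. [cite: King1986, p.664 («By extracting a small part of each propagator …»)] -/
def legWeight (δ : ℝ) (ρ : T → T → ℝ) (o : Option T) (x : T) : ℝ := o.elim 1 fun y => Real.exp (-(δ * ρ x y))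

omit [DecidableEq T] in
/-- reading: unanchored weight `1`. [folklore] -/
@[simp] theorem legWeight_none (δ : ℝ) (ρ : T → T → ℝ) (x : T) : legWeight δ ρ none x = 1 := rfl

omit [DecidableEq T] in
/-- reading: anchored weight `exp[−δρ(x, y)]`. [folklore] -/
@[simp] theorem legWeight_some (δ : ℝ) (ρ : T → T → ℝ) (y x : T) : legWeight δ ρ (some y) x = Real.exp (-(δ * ρ x y)) := rfl

omit [DecidableEq T] in
/-- the leg weight is positive. [folklore] -/
theorem legWeight_pos (δ : ℝ) (ρ : T → T → ℝ) (o : Option T) (x : T) : 0 < legWeight δ ρ o x := by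
  cases o; · exact one_pos
  exact Real.exp_pos _

omit [DecidableEq T] in
/-- the leg weight is at most `1` for `δ ≥ 0`, `ρ ≥ 0`. [folklore] -/
theorem legWeight_le_one {δ : ℝ} (hδ : 0 ≤ δ) {ρ : T → T → ℝ} (hρ : ∀ a b, 0 ≤ ρ a b) (o : Option T) (x : T) : legWeight δ ρ o x ≤ 1 := by
  cases o with
  | none => exact le_rfl
  | some y => exact Real.exp_le_one_iff.2 (neg_nonpos.2 (mul_nonneg hδ (hρ _ _)))
-- (monotonicity in `δ` below)

omit [DecidableEq T] in
/-- the leg weight decreases as the rate grows (`ρ ≥ 0`). [folklore] -/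
theorem legWeight_anti {δ δ' : ℝ} (hδ : δ ≤ δ') {ρ : T → T → ℝ} (hρ : ∀ a b, 0 ≤ ρ a b) (o : Option T) (x : T) :
    legWeight δ' ρ o x ≤ legWeight δ ρ o x := by
  cases o with
  | none => exact le_rfl
  | some y => exact Real.exp_le_exp.2 (neg_le_neg (mul_le_mul_of_nonneg_right hδ (hρ _ _)))

omit [DecidableEq T] [Fintype Υ] in
/-- reading: the leg weight IS `exp[−δ·legLength]` at the placement. [folklore] -/
theorem legWeight_eq_exp (δ : ℝ) (ρ : T → T → ℝ) (σ : Fin (nn + 1) → T) (υ : Υ) :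
    legWeight δ ρ (anch υ) (σ (vtx υ)) = Real.exp (-(δ * legLength vtx anch ρ σ υ)) := by
  unfold legWeight legLength
  cases anch υ with
  | none => simp
  | some y => rfl

/-- **THE EDGES A PLACED GRAPH DRAWS ON THE LATTICE**: the images of its internal lines and of its anchored legs. [cite: King1986, (3.56) p.662] -/
def placedEdges (σ : Fin (nn + 1) → T) : Finset (T × T) :=
  (univ : Finset (Fin m)).image (fun ℓ => (σ (src ℓ), σ (tgt ℓ)))
    ∪ (univ : Finset Υ).biUnion fun υ => ((anch υ).toFinset).image fun y => (σ (vtx υ), y)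

/-- ★ **PART Γ-k's CONNECTEDNESS TRANSPORTED ALONG THE PLACEMENT**: vertices joined through the lines are placed at points joined through the placed edges.
[folklore] -/
theorem eConn_placed_of_lConn (σ : Fin (nn + 1) → T) {a b : Fin (nn + 1)} (h : LConn src tgt univ a b) :
    EConn (placedEdges src tgt vtx anch σ) (σ a) (σ b) := by
  induction h with
  | rel a b hab =>
      obtain ⟨ℓ, -, rfl, rfl⟩ := hab
      exact eConn_of_mem (mem_union_left _ (mem_image.2 ⟨ℓ, mem_univ ℓ, rfl⟩))
  | refl a => exact Relation.ReflTransGen.refl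
  | symm a b _ ih => exact eConn_symm ih
  | trans a b c _ _ ih1 ih2 => exact eConn_trans ih1 ih2

/-- an anchor is joined to the placement of its vertex by its leg. [folklore] -/
theorem eConn_anchor (σ : Fin (nn + 1) → T) {υ : Υ} {y : T} (hy : anch υ = some y) :
    EConn (placedEdges src tgt vtx anch σ) (σ (vtx υ)) y :=
  eConn_of_mem (mem_union_right _ (mem_biUnion.2 ⟨υ, mem_univ υ, mem_image.2 ⟨y, by rw [Option.mem_toFinset, hy]; rfl, rfl⟩⟩))

/-- membership in the anchor set. [folklore] -/
theorem mem_anchors {y : T} : y ∈ anchors anch ↔ ∃ υ, anch υ = some y := by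
  unfold anchors
  simp only [mem_biUnion, mem_univ, true_and, Option.mem_toFinset, Option.mem_def]

/-- ★★ **A CONNECTED PLACED GRAPH CONNECTS ITS ANCHORS**: if every vertex is joined to the vertex `0` through the internal lines (part Γ-k `LConn src tgt univ 0 v`),
then at every placement the placed edges connect the anchor set. [cite: King1986, p.660 («tree graph connecting {u_i}»), (3.56) p.662] -/
theorem connects_placedEdges (hconn : ∀ v, LConn src tgt univ 0 v) (σ : Fin (nn + 1) → T) :
    Connects (anchors anch) (placedEdges src tgt vtx anch σ) := by
  intro u hu v hv
  obtain ⟨υ₁, h₁⟩ := (mem_anchors anch).1 hu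
  obtain ⟨υ₂, h₂⟩ := (mem_anchors anch).1 hv
  have ha : EConn (placedEdges src tgt vtx anch σ) u (σ (vtx υ₁)) := eConn_symm (eConn_anchor src tgt vtx anch σ h₁)
  have hb : EConn (placedEdges src tgt vtx anch σ) (σ (vtx υ₁)) (σ 0) :=
    eConn_symm (eConn_placed_of_lConn src tgt vtx anch σ (hconn (vtx υ₁)))
  have hc : EConn (placedEdges src tgt vtx anch σ) (σ 0) (σ (vtx υ₂)) := eConn_placed_of_lConn src tgt vtx anch σ (hconn (vtx υ₂))
  have hd : EConn (placedEdges src tgt vtx anch σ) (σ (vtx υ₂)) v := eConn_anchor src tgt vtx anch σ h₂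
  exact eConn_trans (eConn_trans (eConn_trans ha hb) hc) hd

omit src tgt vtx anch in
/-- a union is at most as long as its parts (nonnegative length). [folklore] -/
theorem edgeLength_union_le {ρ : T → T → ℝ} (hρ : ∀ a b, 0 ≤ ρ a b) (A B : Finset (T × T)) :
    edgeLength ρ (A ∪ B) ≤ edgeLength ρ A + edgeLength ρ B := by
  unfold edgeLength
  rw [← sum_union_inter]
  exact le_add_of_nonneg_right (sum_nonneg fun e _ => hρ _ _)

omit src tgt vtx anch in
/-- a `biUnion` is at most as long as the sum of its parts (nonnegative length). [folklore] -/
theorem edgeLength_biUnion_le {ρ : T → T → ℝ} (hρ : ∀ a b, 0 ≤ ρ a b) {ι : Type*} (s : Finset ι) (t : ι → Finset (T × T)) :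
    edgeLength ρ (s.biUnion t) ≤ ∑ i ∈ s, edgeLength ρ (t i) := by
  classical
  induction s using Finset.induction_on with
  | empty => simp [edgeLength]
  | insert i s hi ih =>
      rw [biUnion_insert, sum_insert hi]
      exact (edgeLength_union_le hρ _ _).trans (add_le_add le_rfl ih)

/-- ★★ **THE LINES AND LEGS OF A CONNECTED PLACED GRAPH ARE AT LEAST AS LONG AS THE TREE LENGTH OF ITS ANCHORS**:
`treeLength ρ (anchors) ≤ Σ_ℓ ρ(σ(src ℓ), σ(tgt ℓ)) + Σ_υ legLength` at every placement `σ` (`ρ ≥ 0`). [cite: King1986, p.660, (3.56) p.662, p.664] -/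
theorem treeLength_anchors_le [Fintype T] {ρ : T → T → ℝ} (hρ : ∀ a b, 0 ≤ ρ a b) (hconn : ∀ v, LConn src tgt univ 0 v) (σ : Fin (nn + 1) → T) :
    treeLength ρ (anchors anch) ≤ (∑ ℓ, ρ (σ (src ℓ)) (σ (tgt ℓ))) + ∑ υ, legLength vtx anch ρ σ υ := by
  refine (treeLength_le_edgeLength ρ (connects_placedEdges src tgt vtx anch hconn σ)).trans ?_
  unfold placedEdges
  refine (edgeLength_union_le hρ _ _).trans (add_le_add ?_ ?_)
  · unfold edgeLength
    exact sum_image_le_of_nonneg fun e _ => hρ _ _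
  · refine (edgeLength_biUnion_le hρ _ _).trans (sum_le_sum fun υ _ => ?_)
    unfold edgeLength legLength
    cases anch υ with
    | none => simp
    | some y => simp [Option.toFinset_some]

/-- ★★★ **THE PRODUCT OF THE DECAY WEIGHTS IS AT MOST `exp[−δ·treeLength]` AT EVERY PLACEMENT** — the hypothesis `hΘ` of part Α-a's weighted engine for King's
«small part of each propagator»: for `δ ≥ 0`, `ρ ≥ 0` and a connected graph,
`Π_ℓ exp[−δρ(σ(src ℓ), σ(tgt ℓ))]·Π_υ legWeight δ ρ (anch υ) (σ(vtx υ)) ≤ exp[−δ·treeLength ρ (anchors anch)]`. [cite: King1986, p.664 («By extracting a small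
part of each propagator, we get the exponential decay on the right-hand side of (3.56)»), p.660] -/
theorem prod_lineWeight_mul_prod_legWeight_le [Fintype T] {δ : ℝ} (hδ : 0 ≤ δ) {ρ : T → T → ℝ} (hρ : ∀ a b, 0 ≤ ρ a b)
    (hconn : ∀ v, LConn src tgt univ 0 v) (σ : Fin (nn + 1) → T) :
    (∏ ℓ, Real.exp (-(δ * ρ (σ (src ℓ)) (σ (tgt ℓ))))) * ∏ υ, legWeight δ ρ (anch υ) (σ (vtx υ))
      ≤ Real.exp (-(δ * treeLength ρ (anchors anch))) := by
  simp_rw [legWeight_eq_exp vtx anch δ ρ σ]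
  rw [← Real.exp_sum, ← Real.exp_sum, ← Real.exp_add]
  refine Real.exp_le_exp.2 ?_
  have h := mul_le_mul_of_nonneg_left (treeLength_anchors_le src tgt vtx anch hρ hconn σ) hδ
  rw [mul_add, mul_sum, mul_sum] at h
  rw [sum_neg_distrib, sum_neg_distrib]
  linarith

end Placement

end Summit.QuantumFields.YangMills.BalabanUVNodes.N15KingModelRung.Graph

end
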